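import Summits.AtomisticToContinuum.Crystallization.Theorems.PhononSlackCertificatesPeriodicGivenLayeredClosing5
import Summits.AtomisticToContinuum.Crystallization.Theorems.PhononSlackCertificatesPeriodicGivenLayeredConvexity
import Summits.AtomisticToContinuum.Crystallization.Theorems.PhononSlackCertificatesPeriodicGivenLayeredLayerCake3
import Summits.AtomisticToContinuum.Crystallization.Theorems.MinimiserShells.Negative.LoadBearing
import HarnessLib

/-!
# `SlackRigidity` (stmt-AtomisticToContinuum-11960), line `priced-floors-palm-exactification`, stub S3
# (`stub_layeredMeanSelection`): convexity of window energies in the layer spacings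

Lead c19, S3 part 6 (deterministic).  THE PER-SAMPLE INEQUALITY OF THE MEAN INCREMENT ARGUMENT.
For a fault-free admissible layering `(a, s, z)` (word alternating, increments in the box) and a
window of `n+1` consecutive layers starting at `m₁`, let `W(m₁)` be the sum over the window of the
layer energies `Φ₀(a) + Σ'_{m'≠m} Φ(z m' − z m, L m' − L m)`.  Then
`W(m₁) + W(m₁+1) ≥ 4(n+1)e* − C + 2κ Σ_{l<n} (Δ_{m₁+l} − Δ_{m₁+l+1})²`
(`lms_convex_windows`, registered), where `Δ_i = z(i+1) − z i`: by `clo_block_decomposition` both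
window sums are, up to `O(1)`, twice the finite block energies `B(Δ)` / `B(Δ')` of the window's
increments and of the shifted window's increments; by `LayeredHull.stub_convexity`
`B(Δ) + B(Δ') ≥ 2B((Δ+Δ')/2) + κ Σ (Δ_l − Δ'_l)²`; and `2B((Δ+Δ')/2)` is, up to `O(1)`, the window sum
of the MIDPOINT COMPETITOR (heights with the averaged increments inside the window, an admissible
layering), which is `≥ 2(n+1)e* − C_W` by the window bound (hypothesis, = `lms_window_sum_ge`).
All `[folklore]`.
-/

noncomputable section

open MeasureTheory Filter Set
open scoped BigOperators

namespace Summit.AtomisticToContinuum.Crystallization.Theorems.SlackRigidityPricedFloorsConvexWindows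

open Literature.MathematicalPhysics.StatisticalMechanics
open Summit.AtomisticToContinuum.Crystallization.Theorems.LayeredHull
open Summit.AtomisticToContinuum.Crystallization.Theorems.MinimiserShells.Negative.LoadBearing (eStar)

/-! ## The midpoint competitor heights -/

/-- **Splicing increments**: there are heights with prescribed increments `d` on the window
`[m₁, m₁+n)` and the increments of `z` elsewhere (anchored at `z m₁`). [folklore] -/
theorem exists_splice (z : ℤ → ℝ) (m₁ : ℤ) (n : ℕ) (d : ℕ → ℝ) :
    ∃ zc : ℤ → ℝ, ∀ k : ℤ, zc (k + 1) - zc k =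
      if m₁ ≤ k ∧ k < m₁ + n then d (k - m₁).toNat else z (k + 1) - z k := by
  let zc : ℤ → ℝ := fun k =>
    if k ≤ m₁ then z k
    else if k ≤ m₁ + n then z m₁ + ∑ l ∈ Finset.range (k - m₁).toNat, d l
    else z k - z (m₁ + n) + (z m₁ + ∑ l ∈ Finset.range n, d l)
  have hzc : ∀ k, zc k = if k ≤ m₁ then z k
      else if k ≤ m₁ + n then z m₁ + ∑ l ∈ Finset.range (k - m₁).toNat, d l
      else z k - z (m₁ + n) + (z m₁ + ∑ l ∈ Finset.range n, d l) := fun k => rfl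
  -- increments inside the window
  have hin : ∀ l : ℕ, l < n → zc (m₁ + l + 1) - zc (m₁ + l) = d l := by
    intro l hl
    rw [hzc, hzc (m₁ + l)]
    have h1 : ¬ (m₁ + l + 1 ≤ m₁) := by omega
    have h2 : m₁ + l + 1 ≤ m₁ + n := by omega
    have h3 : (m₁ + l + 1 - m₁).toNat = l + 1 := by omega
    rw [if_neg h1, if_pos h2, h3, Finset.sum_range_succ]
    rcases Nat.eq_zero_or_pos l with rfl | hl0
    · simp
    · have h4 : ¬ (m₁ + l ≤ m₁) := by omega
      have h5 : m₁ + l ≤ m₁ + n := by omega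
      have h6 : (m₁ + l - m₁).toNat = l := by omega
      rw [if_neg h4, if_pos h5, h6]
      ring
  -- increments outside the window
  have hout : ∀ k : ℤ, (k < m₁ ∨ m₁ + n ≤ k) → zc (k + 1) - zc k = z (k + 1) - z k := by
    intro k hk
    rw [hzc, hzc k]
    rcases hk with hk | hk
    · rw [if_pos (by omega : k + 1 ≤ m₁), if_pos (by omega : k ≤ m₁)]
    · by_cases hkn : k ≤ m₁ + n
      · have hk' : k = m₁ + n := le_antisymm hkn hk
        subst hk'
        rw [if_neg (by omega : ¬ (m₁ + n + 1 ≤ m₁)), if_neg (by omega : ¬ (m₁ + n + 1 ≤ m₁ + n))]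
        rcases Nat.eq_zero_or_pos n with rfl | hn0
        · simp
        · rw [if_neg (by omega : ¬ (m₁ + (n : ℤ) ≤ m₁)), if_pos le_rfl,
            show (m₁ + (n : ℤ) - m₁).toNat = n by omega]
          ring
      · rw [if_neg (by omega : ¬ (k + 1 ≤ m₁)), if_neg (by omega : ¬ (k + 1 ≤ m₁ + n)),
          if_neg (by omega : ¬ (k ≤ m₁)), if_neg hkn]
        ring
  refine ⟨zc, fun k => ?_⟩
  split_ifs with h
  · have := hin (k - m₁).toNat (by omega)
    rwa [show m₁ + ((k - m₁).toNat : ℕ) = k by omega] at this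
  · exact hout k (by omega)

/-! ## The convexity inequality for window sums -/

/-- **Convexity of window energies in the spacings** (registered sub-goal `lms_convex_windows`): see
the module docstring.  The first hypothesis is the window bound (`lms_window_sum_ge` with the frame
suppressed). [folklore] -/
theorem lms_convex_windows : ∀ (CW : ℝ), (∀ (a : ℝ) (s : ℤ → ℤ) (z : ℤ → ℝ), 47 / 50 ≤ a → a ≤ 1 → (∀ m : ℤ, 39 / 50 * a ≤ z (m + 1) - z m) → ∀ (m₁ : ℤ) (n : ℕ), 2 * (n : ℝ) * eStar - CW ≤ ∑ m ∈ Finset.Ico m₁ (m₁ + n), (inLayerInteraction lennardJones a + ∑' m' : ℤ, if m' = m then (0 : ℝ) else layerInteraction lennardJones a (z m' - z m) (haggLabel s m' - haggLabel s m) 1)) → ∃ κ C : ℝ, 0 < κ ∧ 0 ≤ C ∧ ∀ (a : ℝ) (s : ℤ → ℤ) (z : ℤ → ℝ), 47 / 50 ≤ a → a ≤ 1 → IsHaggSeq s → (∀ m : ℤ, s (m + 1) = -s m) → (∀ m : ℤ, 39 / 50 * a ≤ z (m + 1) - z m ∧ z (m + 1) - z m ≤ 17 / 20 * a) → ∀ (m₁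 : ℤ) (n : ℕ), 4 * ((n : ℝ) + 1) * eStar - C + 2 * κ * ∑ l ∈ Finset.range n, ((z (m₁ + l + 1) - z (m₁ + l)) - (z (m₁ + l + 2) - z (m₁ + l + 1))) ^ 2 ≤ (∑ m ∈ Finset.Ico m₁ (m₁ + ((n + 1 : ℕ) : ℤ)), (inLayerInteraction lennardJones a + ∑' m' : ℤ, if m' = m then (0 : ℝ) else layerInteraction lennardJones a (z m' - z m) (haggLabel s m' - haggLabel s m) 1)) + ∑ m ∈ Finset.Ico (m₁ + 1) (m₁ + 1 + ((n + 1 : ℕ) : ℤ)), (inLayerInteraction lennardJones a + ∑' m' : ℤ, if m' = m then (0 : ℝ) else layerInteraction lennardJones a (z m' - z m) (haggLabel s m' - haggLabel s m) 1) := by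
  intro CW hW
  obtain ⟨κ, hκ, hconv⟩ := stub_convexity
  -- the window bound constant may be taken nonnegative
  have hW' : ∀ (a : ℝ) (s : ℤ → ℤ) (z : ℤ → ℝ), 47 / 50 ≤ a → a ≤ 1 →
      (∀ m : ℤ, 39 / 50 * a ≤ z (m + 1) - z m) → ∀ (m₁ : ℤ) (n : ℕ),
      2 * (n : ℝ) * eStar - max CW 0 ≤ ∑ m ∈ Finset.Ico m₁ (m₁ + n), (inLayerInteraction lennardJones a +
        ∑' m' : ℤ, if m' = m then (0 : ℝ) else
          layerInteraction lennardJones a (z m' - z m) (haggLabel s m' - haggLabel s m) 1) :=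
    fun a s z ha ha1 hz m₁ n => (by linarith [hW a s z ha ha1 hz m₁ n, le_max_left CW 0])
  refine ⟨κ, 2 * max CW 0 + 4 * (16 * 192) + 2 * (16 * 192), hκ, by positivity, ?_⟩
  intro a s z ha ha1 hs hfree hz m₁ n
  have hzlo : ∀ m : ℤ, 39 / 50 * a ≤ z (m + 1) - z m := fun m => (hz m).1
  have hdecay : ∀ (H : ℝ) (δ : ℤ), 7 / 10 ≤ |H| → |layerInteraction lennardJones a H δ 1| ≤ 192 / H ^ 4 :=
    fun H δ hH => cake_abs_layerInteraction_le a H ha ha1 hH δ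
  -- abbreviations
  set Φ₀ : ℝ := inLayerInteraction lennardJones a with hΦ₀
  set T : (ℤ → ℝ) → ℤ → ℝ := fun z' m => ∑' m' : ℤ, if m' = m then (0 : ℝ) else
    layerInteraction lennardJones a (z' m' - z' m) (haggLabel s m' - haggLabel s m) 1 with hT
  set B : (ℕ → ℝ) → ℝ := fun Δ => ∑ i ∈ Finset.range n, ∑ j ∈ Finset.Ioc i n,
    layerInteraction lennardJones a (∑ l ∈ Finset.Ico i j, Δ l) (if Even (j - i) then 0 else 1) 1 with hB
  -- the increments of the two windows and their midpoint
  set Δ : ℕ → ℝ := fun l => z (m₁ + l + 1) - z (m₁ + l) with hΔ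
  set Δ' : ℕ → ℝ := fun l => z (m₁ + 1 + l + 1) - z (m₁ + 1 + l) with hΔ'
  set Δm : ℕ → ℝ := fun l => (Δ l + Δ' l) / 2 with hΔm
  have hΔbox : ∀ i, i < n → 39 / 50 * a ≤ Δ i ∧ Δ i ≤ 17 / 20 * a := fun i _ => hz _
  have hΔ'box : ∀ i, i < n → 39 / 50 * a ≤ Δ' i ∧ Δ' i ≤ 17 / 20 * a := fun i _ => hz _
  have hΔmbox : ∀ i, 39 / 50 * a ≤ Δm i ∧ Δm i ≤ 17 / 20 * a := by
    intro i
    have h1 := hz (m₁ + i); have h2 := hz (m₁ + 1 + i)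
    simp only [hΔm, hΔ, hΔ']
    constructor <;> linarith [h1.1, h1.2, h2.1, h2.2]
  -- (1) block decompositions of the two actual windows
  have hsumz : ∀ m : ℤ, Summable fun m' : ℤ => if m' = m then (0 : ℝ) else
      layerInteraction lennardJones a (z m' - z m) (haggLabel s m' - haggLabel s m) 1 :=
    cake_summable_layers a ha ha1 s z hzlo
  have hd1 := clo_block_decomposition ha hs hfree hz hdecay hsumz m₁ n
  have hd2 := clo_block_decomposition ha hs hfree hz hdecay hsumz (m₁ + 1) n
  -- (2) the midpoint competitor and its block decomposition + window bound
  obtain ⟨zc, hzc_incr⟩ := exists_splice z m₁ n Δm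
  have hzcbox : ∀ m : ℤ, 39 / 50 * a ≤ zc (m + 1) - zc m ∧ zc (m + 1) - zc m ≤ 17 / 20 * a := by
    intro m
    rw [hzc_incr]
    split_ifs
    · exact hΔmbox _
    · exact hz m
  have hzclo : ∀ m : ℤ, 39 / 50 * a ≤ zc (m + 1) - zc m := fun m => (hzcbox m).1
  have hsumzc : ∀ m : ℤ, Summable fun m' : ℤ => if m' = m then (0 : ℝ) else
      layerInteraction lennardJones a (zc m' - zc m) (haggLabel s m' - haggLabel s m) 1 :=
    cake_summable_layers a ha ha1 s zc hzclo
  have hd3 := clo_block_decomposition ha hs hfree hzcbox hdecay hsumzc m₁ n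
  have hwin := hW' a s zc ha ha1 hzclo m₁ (n + 1)
  -- the competitor's window increments are the midpoints
  have hBc : (∑ i ∈ Finset.range n, ∑ j ∈ Finset.Ioc i n, layerInteraction lennardJones a
      (∑ l ∈ Finset.Ico i j, (zc (m₁ + l + 1) - zc (m₁ + l))) (if Even (j - i) then 0 else 1) 1) = B Δm := by
    simp only [hB]
    refine Finset.sum_congr rfl fun i hi => Finset.sum_congr rfl fun j hj => ?_
    congr 1
    refine Finset.sum_congr rfl fun l hl => ?_
    have hln : l < n := by
      simp only [Finset.mem_range] at hi
      simp only [Finset.mem_Ioc] at hj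
      simp only [Finset.mem_Ico] at hl
      omega
    rw [hzc_incr, if_pos ⟨by omega, by omega⟩]
    congr 1
    omega
  -- (3) convexity
  have hcv := hconv a ha ha1 n Δ Δ' hΔbox hΔ'box
  -- (4) assemble
  have hB1 : (∑ i ∈ Finset.range n, ∑ j ∈ Finset.Ioc i n, layerInteraction lennardJones a
      (∑ l ∈ Finset.Ico i j, (z (m₁ + l + 1) - z (m₁ + l))) (if Even (j - i) then 0 else 1) 1) = B Δ := rfl
  have hB2 : (∑ i ∈ Finset.range n, ∑ j ∈ Finset.Ioc i n, layerInteraction lennardJones a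
      (∑ l ∈ Finset.Ico i j, (z (m₁ + 1 + l + 1) - z (m₁ + 1 + l))) (if Even (j - i) then 0 else 1) 1) = B Δ' :=
    rfl
  have hBm : (∑ i ∈ Finset.range n, ∑ j ∈ Finset.Ioc i n, layerInteraction lennardJones a
      (∑ l ∈ Finset.Ico i j, (Δ l + Δ' l) / 2) (if Even (j - i) then 0 else 1) 1) = B Δm := rfl
  rw [hB1] at hd1
  rw [hB2] at hd2
  rw [hBc] at hd3
  rw [hBm] at hcv
  -- split the window sums into `(n+1) Φ₀ + Σ T`
  have hsplit : ∀ (z' : ℤ → ℝ) (m₀ : ℤ), ∑ m ∈ Finset.Ico m₀ (m₀ + ((n + 1 : ℕ) : ℤ)),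
      (Φ₀ + T z' m) = ((n + 1 : ℕ) : ℝ) * Φ₀ + ∑ m ∈ Finset.Ico m₀ (m₀ + ((n + 1 : ℕ) : ℤ)), T z' m := by
    intro z' m₀
    rw [Finset.sum_add_distrib, Finset.sum_const, nsmul_eq_mul]
    congr 2
    rw [Int.card_Ico]
    simp
  have e1 := hsplit z m₁
  have e2 := hsplit z (m₁ + 1)
  have e3 := hsplit zc m₁
  simp only [hT] at e1 e2 e3
  rw [e1, e2]
  rw [e3] at hwin
  have hjumps : ∑ l ∈ Finset.range n, ((z (m₁ + l + 1) - z (m₁ + l)) - (z (m₁ + l + 2) - z (m₁ + l + 1))) ^ 2 =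
      ∑ i ∈ Finset.range n, (Δ i - Δ' i) ^ 2 := by
    refine Finset.sum_congr rfl fun l _ => ?_
    simp only [hΔ, hΔ']
    ring_nf
  rw [hjumps]
  have habs1 := (abs_le.1 hd1)
  have habs2 := (abs_le.1 hd2)
  have habs3 := (abs_le.1 hd3)
  push_cast at hwin habs1 habs2 habs3 ⊢
  nlinarith [habs1.1, habs1.2, habs2.1, habs2.2, habs3.1, habs3.2, hwin, hcv, le_max_right CW 0]

end Summit.AtomisticToContinuum.Crystallization.Theorems.SlackRigidityPricedFloorsConvexWindows

end
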